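import Literature.Analysis.OperatorTheory.GroundStateMarkovGap
import HarnessLib

/-!
# Crux `IR` (stmt-QuantumFields-19354), line `vacuum_escape`, seam `stub_cheeger` — part 3: the pointwise ground state of a strictly
# positive transfer kernel inside an eigenbasis (Perron–Frobenius–Jentzsch data)

Helper module for item `stmt-QuantumFields-19354` (`--supports … --as helper`; closes nothing by itself).  Abstract setting: a probability space
`(X, μ)`, a bounded symmetric strongly measurable kernel `K` with a UNIFORM lower bound `K ≥ κ₀ > 0`, its `L²` operator `A` (self-adjoint,
compact, positivity improving), and a Hilbert basis of eigenvectors `A bᵢ = λᵢ bᵢ`, `λᵢ ≥ 0`, with a top index `λ_{i₀} = ‖A‖`.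
`exists_groundState_data` packages what the Cheeger seam needs: a bounded measurable pointwise eigenfunction `h` with `∫ K(x,y)h(y) = λ_{i₀} h(x)`,
`∫ h² = 1`, `h ≥ h₀ > 0`, such that `b_{i₀} = ± h` a.e., `∫ h bᵢ = 0` for `i ≠ i₀`, and Jentzsch's gap `λᵢ ≤ θ < λ_{i₀}` (`i ≠ i₀`) — assembled BY
NAME from the tree (`IsPositivityImproving.exists_spectralGap`, `PositiveKernelEigenfunction.exists_pointwise_eigenfunction`,
`GroundStateMarkovGap.toLp_eigenfunction_eq_norm`).

HONEST FRAMING: transfer-operator bookkeeping; nothing here bears on weak coupling or the YM mass gap.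
Refs: M. Reed, B. Simon IV, Thm XIII.43–44 (Perron–Frobenius–Jentzsch); tree files named above.
-/

set_option autoImplicit false

noncomputable section

open MeasureTheory Filter Set Function
open scoped RealInnerProductSpace ENNReal Topology
open Literature.Analysis.OperatorTheory

namespace Summit.QuantumFields.YangMills.Cruxes.IR.VacuumEscape.GroundState

variable {X : Type*} [MeasurableSpace X] {μ : Measure X} [IsProbabilityMeasure μ] {K : X → X → ℝ} {C : ℝ}
  {A : Lp ℝ 2 μ →L[ℝ] Lp ℝ 2 μ} {ι : Type*} {b : HilbertBasis ι ℝ (Lp ℝ 2 μ)} {lam : ι → ℝ}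

/-- **Ground-state data in an eigenbasis** (Perron–Frobenius–Jentzsch).  For a bounded symmetric strongly measurable kernel `K ≥ κ₀ > 0` with
`L²` operator `A` (self-adjoint, compact, positivity improving, `≠ 0`) and a Hilbert basis of eigenvectors `A bᵢ = λᵢ bᵢ`, `λᵢ ≥ 0`,
`λ_{i₀} = ‖A‖`: there are a measurable `h` with `‖h‖ ≤ B`, `h ≥ h₀ > 0`, `∫ K(x,y) h(y) dμ(y) = λ_{i₀} h(x)` for every `x`, `∫ h² = 1`,
`b_{i₀} = ε h` a.e. with `ε² = 1`, `∫ h bᵢ = 0` for `i ≠ i₀`, and `0 ≤ θ < λ_{i₀}` with `λᵢ ≤ θ` for all `i ≠ i₀`. -/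
theorem exists_groundState_data (hK : StronglyMeasurable (uncurry K)) (hC : ∀ x y, ‖K x y‖ ≤ C)
    (hsymm : ∀ x y, K x y = K y x) (hpos : ∀ x y, 0 < K x y) {κ₀ : ℝ} (hκ₀ : 0 < κ₀) (hKmin : ∀ x y, κ₀ ≤ K x y)
    (hA : ∀ φ : Lp ℝ 2 μ, (A φ : X → ℝ) =ᵐ[μ] fun x => ∫ y, K x y * φ y ∂μ)
    (hsa : IsSelfAdjoint A) (hcpt : IsCompactOperator A) (himp : IsPositivityImproving A) (hA0 : A ≠ 0)
    (hb : ∀ i, A (b i) = lam i • b i) (hlam0 : ∀ i, 0 ≤ lam i) {i₀ : ι} (hi₀ : lam i₀ = ‖A‖) :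
    ∃ (h : X → ℝ) (B h₀ θ : ℝ), Measurable h ∧ (∀ x, ‖h x‖ ≤ B) ∧ 0 < h₀ ∧ (∀ x, h₀ ≤ h x) ∧
      (∀ x, ∫ y, K x y * h y ∂μ = lam i₀ * h x) ∧ ∫ x, h x ^ 2 ∂μ = 1 ∧
      (∃ ε : ℝ, ε ^ 2 = 1 ∧ (b i₀ : X → ℝ) =ᵐ[μ] fun x => ε * h x) ∧
      (∀ i, i ≠ i₀ → ∫ x, h x * b i x ∂μ = 0) ∧
      0 ≤ θ ∧ θ < lam i₀ ∧ ∀ i, i ≠ i₀ → lam i ≤ θ := by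
  classical
  have hμ : μ ≠ 0 := IsProbabilityMeasure.ne_zero μ
  -- Jentzsch: the simple top eigenvalue and the gap
  obtain ⟨φ, hφ1, hφpos, hAφ, hsimple, θ, hθ0, hθ, hgap⟩ := himp.exists_spectralGap hsa hcpt hA0
  -- the pointwise eigenfunction
  obtain ⟨lam', h, B, hlam', hhm, hhpos, hhle, hint, heig, hsqi, hnorm⟩ :=
    exists_pointwise_eigenfunction (μ := μ) hK hC hsymm hpos hμ
  have hhb : ∀ x, ‖h x‖ ≤ B := fun x => by
    rw [Real.norm_eq_abs, abs_of_pos (hhpos x)]; exact hhle x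
  obtain ⟨-, hlamA, hcpos, hhL⟩ := toLp_eigenfunction_eq_norm hμ hA hsa hφpos hAφ hsimple hhm hhpos hhb heig
  set hL : Lp ℝ 2 μ := (memLp_two_of_bound (μ := μ) hhm hhb).toLp h with hhLdef
  have hcoe : (hL : X → ℝ) =ᵐ[μ] h := MemLp.coeFn_toLp _
  -- `‖[h]‖ = 1`, hence `[h] = φ`
  have hnormL : ‖hL‖ = 1 := by
    have h1 := norm_toLp_sq_eq_integral_norm_sq (𝕜 := ℝ) (memLp_two_of_bound (μ := μ) hhm hhb)
    have h2 : ∫ x, ‖h x‖ ^ 2 ∂μ = 1 := by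
      rw [← hnorm]; refine integral_congr_ae (Eventually.of_forall fun x => ?_); simp only [Real.norm_eq_abs, sq_abs]
    rw [h2] at h1
    have h3 : ‖hL‖ ^ 2 = 1 := h1
    nlinarith [norm_nonneg hL]
  have hc1 : ⟪φ, hL⟫ = 1 := by
    have h1 : ‖hL‖ = |⟪φ, hL⟫| * ‖φ‖ := by
      conv_lhs => rw [hhL]
      rw [norm_smul, Real.norm_eq_abs]
    rw [hnormL, hφ1, mul_one, abs_of_pos hcpos] at h1
    exact h1.symm
  have hLφ : hL = φ := by rw [hhL, hc1, one_smul]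
  -- `b_{i₀} = ε φ`, `ε² = 1`
  have hbi₀ : A (b i₀) = ‖A‖ • b i₀ := by rw [hb i₀, hi₀]
  set ε : ℝ := ⟪φ, b i₀⟫ with hεdef
  have hbε : b i₀ = ε • φ := hsimple (b i₀) hbi₀
  have hε2 : ε ^ 2 = 1 := by
    have h1 : ‖b i₀‖ = |ε| * ‖φ‖ := by
      conv_lhs => rw [hbε]
      rw [norm_smul, Real.norm_eq_abs]
    rw [b.orthonormal.norm_eq_one i₀, hφ1, mul_one] at h1
    rw [← sq_abs, ← h1, one_pow]
  have hεne : ε ≠ 0 := fun h0 => by rw [h0] at hε2; norm_num at hε2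
  -- orthogonality of the other basis vectors to `φ = [h]`
  have horthφ : ∀ i, i ≠ i₀ → ⟪φ, b i⟫ = 0 := by
    intro i hi
    have h1 : ⟪b i₀, b i⟫ = 0 := by
      rw [orthonormal_iff_ite.1 b.orthonormal i₀ i, if_neg (Ne.symm hi)]
    rw [hbε, real_inner_smul_left] at h1
    rcases mul_eq_zero.1 h1 with h2 | h2
    · exact absurd h2 hεne
    · exact h2
  -- the positive lower bound of `h`
  have hhint : Integrable h μ := Integrable.of_bound hhm.aestronglyMeasurable B (Eventually.of_forall hhb)
  have hIpos : 0 < ∫ x, h x ∂μ := by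
    rw [integral_pos_iff_support_of_nonneg (fun x => (hhpos x).le) hhint]
    have hsupp : Function.support h = univ := by
      ext x; simp [(hhpos x).ne']
    rw [hsupp, measure_univ]; exact one_pos
  set h₀ : ℝ := lam'⁻¹ * (κ₀ * ∫ x, h x ∂μ) with hh₀def
  have hh₀ : 0 < h₀ := mul_pos (inv_pos.2 hlam') (mul_pos hκ₀ hIpos)
  have hlow : ∀ x, h₀ ≤ h x := by
    intro x
    have h1 : κ₀ * ∫ y, h y ∂μ ≤ ∫ y, K x y * h y ∂μ := by
      rw [← integral_const_mul]
      exact integral_mono (hhint.const_mul κ₀) (hint x) fun y => mul_le_mul_of_nonneg_right (hKmin x y) (hhpos y).le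
    rw [heig x] at h1
    calc h₀ = lam'⁻¹ * (κ₀ * ∫ y, h y ∂μ) := rfl
      _ ≤ lam'⁻¹ * (lam' * h x) := mul_le_mul_of_nonneg_left h1 (inv_nonneg.2 hlam'.le)
      _ = h x := by rw [← mul_assoc, inv_mul_cancel₀ hlam'.ne', one_mul]
  have hlamA' : lam' = lam i₀ := by rw [hlamA, hi₀]
  refine ⟨h, B, h₀, θ, hhm, hhb, hh₀, hlow, fun x => by rw [heig x, hlamA'], hnorm, ⟨ε, hε2, ?_⟩, fun i hi => ?_,
    hθ0, by rw [hi₀]; exact hθ, fun i hi => ?_⟩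
  · -- `b_{i₀} = ε h` a.e.
    rw [hbε, ← hLφ]
    filter_upwards [Lp.coeFn_smul ε hL, hcoe] with x hx hcx
    rw [hx, Pi.smul_apply, smul_eq_mul, hcx]
  · -- `∫ h bᵢ = ⟪[h], bᵢ⟫ = ⟪φ, bᵢ⟫ = 0`
    have h1 : ∫ x, h x * b i x ∂μ = ⟪hL, b i⟫ := by
      rw [inner_eq_integral]
      refine integral_congr_ae ?_
      filter_upwards [hcoe] with x hx
      rw [hx]
    rw [h1, hLφ, horthφ i hi]
  · -- Jentzsch's gap on `φ^⊥`
    have h1 := hgap (b i) (horthφ i hi)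
    rw [hb i, norm_smul, Real.norm_eq_abs, abs_of_nonneg (hlam0 i), b.orthonormal.norm_eq_one i, mul_one, mul_one] at h1
    exact h1

end Summit.QuantumFields.YangMills.Cruxes.IR.VacuumEscape.GroundState

end
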